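import Mathlib
import HarnessLib
import HarnessLib.Audit
import Summits.AtomisticToContinuum.Statement
import Literature.MathematicalPhysics.KineticTheory.LangevinChainKernel
import Literature.MathematicalPhysics.KineticTheory.LangevinChainGibbs
import Literature.MathematicalPhysics.KineticTheory.LangevinChainNESSHolds
import Summits.AtomisticToContinuum.FouriersLaw.Theorems.EmbeddedDrudeMourreNessUnique
import HarnessLib.Audit.Status.Attr

/-!
Route: GriffithsLimitExchange

DORMANT since 2026-08-22T03:24:29Z (reconciler: no traction for 5 d (last activity item-evidence-added at 2026-08-17T02:12:43Z); parked, not closed — `ledger route dormant route-AtomisticToContinuum-GriffithsLimitExchange --off` to reac) — unstaffed, not closed; items shared with open routes are served there. `ledger route dormant <id> --off` reactivates.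

# Route GriffithsLimitExchange — dynamical Griffiths sign exchanges t→∞ with N→∞ — Fourier from
finite-horizon transmission

Conforming re-filing of card dynamical-energy-positivity-dep (prior rung route DynamicalGriffiths
retired 2026-08-15 `not-a-thesis`). Notation: P = pinnedChain ω₂ lam β γ (all > 0), N-chain with
BOTH Langevin baths at T > 0 (Gibbs μ_T = P.gibbsMeasure N T stationary; P_u = P.transitionKernel N
T T u, CONSTRUCTED in tree); boundary kinetic kernels K_N(u) := ∫(p_0²−T)·P_u(p_0²−T)dμ_T (return)
and Kt_N(u) := ∫(p_0²−T)·P_u(p²_{N−1}−T)dμ_T (transmission); X_N(t) := (γ/T²)∫_0^t Kt_N (energy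
injected at the left bath that has LEFT through the right bath by time t), S_N(t) := (γ/T²)∫_t^∞
(K_N + Kt_N) (= the fraction still inside the chain, by the exit identity), E_N := X_N(∞) the
end-to-end transmission; KDN linear response gives D_N = (N−1)·γ·E_N.
It suffices to show X = DEP_b ∧ FH ∧ VS ∧ PT: (DEP_b, BoundaryDEP) the DYNAMICAL GRIFFITHS
INEQUALITY at the two thermostatted sites, K_N(u) ≥ 0 and Kt_N(u) ≥ 0 for all N, u ≥ 0; (FH,
FiniteHorizonTransmission) for every macroscopic horizon A > 0, N·X_N(A·N²) has a (finite) limit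
x_T(A) as N → ∞; (VS, VanishingSurvival) limsup_N N·S_N(A·N²) → 0 as A → ∞; (PT,
PositiveTransmission) N·X_N(A₀N²) ≥ c > 0 eventually, for one A₀. DEP_b is the Tauberian input: it
gives, for EVERY t, the sandwich X_N(t) ≤ E_N ≤ X_N(t) + S_N(t), so the t = ∞ object hidden in the
steady state is squeezed between finite-horizon objects and N·E_N → e(T) = sup_A x_T(A) ∈ (0,∞)
(SandwichGlue, real analysis); with ResponseIdentity, NessUnique and the PROVED existence of steady
states, D_N → γe(T) and FouriersLaw follows (closes, proved sorry-free in Sketch.lean).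
Lean: `∀ ω₂ lam β γ : ℝ, 0 < ω₂ → 0 < lam → 0 < β → 0 < γ → ∀ T : ℝ, 0 < T → (let P :=
Literature.MathematicalPhysics.KineticTheory.HeatConduction.pinnedChain ω₂ lam β γ; let Kt : ℕ → ℝ →
ℝ := fun N u => if h : 0 < N then ∫ z, ((z.2 ⟨0, h⟩) ^ 2 - T) * (∫ y, ((y.2 ⟨N - 1, by omega⟩) ^ 2 -
T) ∂(P.transitionKernel N T T u.toNNReal z)) ∂(P.gibbsMeasure N T) else 0; let E : ℕ → ℝ := fun N =>
γ / T ^ 2 * ∫ u in Set.Ioi (0 : ℝ), Kt N u; ∃ κb : ℝ, 0 < κb ∧ Filter.Tendsto (fun N : ℕ => ((N : ℝ)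
- 1) * γ * E N) Filter.atTop (nhds κb))`

## Assembly
Both glue layers are machine-checked: `sandwichGlue_holds : SandwichGlue` (GlueCheck.lean, rc 0) and
the deciding theorem `closes (hDEP : BoundaryDEP) (hKI : KernelIntegrable) (hFH :
FiniteHorizonTransmission) (hPT : PositiveTransmission) (hVS : VanishingSurvival) (hSG :
SandwichGlue) (hRI : ResponseIdentity) (hNU : NessUnique) : _root_.FouriersLaw` PROVED sorry-free in
the planner's Sketch.lean (lean check rc 0, axioms propext/Classical.choice/Quot.sound): clause (i)
from the landed
Literature.MathematicalPhysics.KineticTheory.HeatConduction.pinnedChain_exists_isSteadyState +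
NessUnique; clause (ii): TransmissionLaw := hSG hDEP hKI hFH hPT hVS, κ T := its Classical.choose
witness for T > 0 (else 1), positivity from the witness, and for a steady-state family D_N :=
(N−1)γE_N with the difference-quotient limits supplied by ResponseIdentity (higher-order pattern
unification fixes D). No averaged/analogue statement: the conclusion is the Statement decl
`FouriersLaw` by name.

Rationale: WHY THIS LINE. Mechanism: POSITIVITY COMMUTES THE TWO LIMITS. BLR's κ takes δT → 0 at fixed N (a t =
∞ time-integral of equilibrium correlations, KunduDharNarayan2009; BonettoLebowitzReyBellet2000
§5.3, §7: "not even clear how to prove κ = κ_GK") and then N → ∞, while every hydrodynamic or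
kinetic method controls correlations only up to a FINITE macroscopic horizon t = A·N²; without extra
input the tails ∫_{AN²}^∞ are governed by relaxation rates that close with N (BeckerMenegaki2022,
catalogued barrier) — the order-of-limits obstruction of the whole sub-problem (Dhar2008 §2.2, §9).
A sign removes it with no rate at all: if the two boundary kernels are nonnegative (the card's
dynamical Griffiths/FKG inequality, restricted to the sites where the card's three anchors are
strongest — Isserlis at lam = β = 0, RiederLebowitzLieb1967/Nakazawa1970; positive linearised phonon
Boltzmann kernel, AokiLukkarinenSpohn2006 §3; heat kernel; and EXACT in the dual/noisy models, KMP
doi:10.1007/bf01011740, BasileBernardinOlla2009), cumulative transmissions never overshoot, and the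
steady-state transmission E_N is bracketed by what has crossed and what is still inside at any
finite time — a monotone-convergence/Tauberian use of positivity imported from probability
(gambler's-ruin bookkeeping for a sub-stochastic kernel; no Markov property in the sites is used or
claimed). What remains — FH (no ballistic channel: N·X_N(AN²) stays finite and converges), VS (no
sub-diffusive trapping), PT (not an insulator) — are finite-horizon, dimensionless statements about
ONE boundary observable of finite equilibrium chains (no infinite-volume dynamics, no κ = κ_GK
identification, no local equilibrium), each failing in exactly one transport regime (harmonic chain:
DEP_b and VS hold, FH fails). What no prior route does: FourierGreenKubo needs L¹(0,∞) decay of the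
infinite-volume current autocorrelation; EscapeDeficit (retired) posits two-sided t^{-1/2} half-line
tail laws plus crossover constants and IMPORTS limit-existence as bare non-oscillation; here
limit-existence and boundedness are DERIVED from the sign, and the analytic cruxes live at finite
macroscopic time where hydrodynamic-limit technology operates (KipnisLandim1999; for noisy chains
BernardinOlla2005, Bernardin2014).

RANKED CRUXES. #0 TransmissionLaw (target) — TRANSMISSION LAW (= X_b of the retired EscapeDeficit in
transmission form): for all parameters > 0 and T > 0 there is κ_b > 0 with (N−1)·γ·E_N → κ_b, E_N =
(γ/T²)∫_0^∞ Kt_N(u)du the end-to-end kinetic-energy transmission of the equilibrium N-chain (N = 0: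
kernels are 0 by convention). Conclusion of SandwichGlue; with ResponseIdentity it is clause (ii) of
FouriersLawFor with κ = κ_b. (why it might fail: Inherits FH (a residual ballistic channel makes
N·E_N → ∞, as for lam = β = 0), PT (localisation-like suppression E_N = o(1/N)) and VS; and it
presumes D_N ∝ E_N (ResponseIdentity).) [KunduDharNarayan2009, BonettoLebowitzReyBellet2000,
RiederLebowitzLieb1967, Dhar2008]
#2 BoundaryDEP (crux) — DYNAMICAL GRIFFITHS INEQUALITY AT THE THERMOSTATTED SITES (card conjecture
DEP_kin restricted to the pairs (0,0) and (0,N−1)): for all ω₂, lam, β, γ > 0, T > 0, every N ≥ 1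
and u ≥ 0, K_N(u) = Cov_T(p_0²(0), p_0²(u)) ≥ 0 and Kt_N(u) = Cov_T(p_0²(0), p²_{N−1}(u)) ≥ 0
(constructed kernels, Gibbs state, both baths at T): kinetic energy injected at a bath site is, on
average, never missing at either bath site later. Exact at lam = β = 0 (Isserlis: 2Cov(p_0,p_y(u))²
≥ 0, with double zeros), in KMP/noisy duals, and at leading kinetic order. Only the TAIL form ∫_t^∞
≥ 0 is used by the glue. [difficulty: open-problem] (why it might fail: At the harmonic double zeros
(quarter periods, echo/arrival times) the O(lam,β) flow correction decides the sign (+3lamT³ by hand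
only for N=1, γ→0); at fixed small N a complex slowest even mode would make K oscillate around 0 at
late u; strong damping γ ≫ ω₂ untested.) [doi:10.1063/1.1664600, doi:10.1007/s002200050102,
doi:10.1007/bf01011740, RiederLebowitzLieb1967, AokiLukkarinenSpohn2006, Zhao2006, LiuEtAl2014,
KunduDharNarayan2009]
#3 FiniteHorizonTransmission (crux) — FINITE-HORIZON TRANSMISSION HAS A SCALING LIMIT: for all
parameters > 0, T > 0 and every macroscopic horizon A > 0, N·X_N(A·N²) = N·(γ/T²)∫_0^{AN²} Kt_N(u)du
converges to a real number x_T(A) as N → ∞ — the energy that has crossed the chain by the diffusive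
time AN² is (x_T(A) + o(1))/N. Finiteness is the no-ballistic-channel content (false for the
harmonic chain, where X_N → E_∞ > 0); existence of the limit is a two-point equilibrium-fluctuation
(linearised hydrodynamic) statement at FINITE macroscopic time, expected x_T(A) = e(T)·F(A) with F
the transmitted fraction of the heat kernel on [0,1] with absorbing ends. [difficulty: open-problem]
(why it might fail: A residual ballistic/superdiffusive channel at some (lam,β,T) gives N·X_N(AN²) →
∞; even if O(1), the N→∞ limit may fail to exist without a hydrodynamic limit for the deterministic
bulk (macro-ergodicity unproved); O(1) Kapitza layers must converge too.)
[BonettoLebowitzReyBellet2000, Spohn2014, MendlSpohn2015, Bernardin2014, KipnisLandim1999,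
LepriLiviPoliti2003, AokiLukkarinenSpohn2006]
#4 VanishingSurvival (crux) — VANISHING DIFFUSIVE SURVIVAL: for all parameters > 0 and T > 0: for
every ε > 0 there is a horizon A with N·S_N(A·N²) ≤ ε for all large N, where S_N(t) = (γ/T²)∫_t^∞
(K_N + Kt_N) — by the exit identity γ(∫_0^∞K_N + ∫_0^∞Kt_N) = T² and energy balance, S_N(t) =
Cov_T(p_0²(0), H_N(t))/T² is the fraction of the injected boundary energy still inside the chain at
time t. Says: boundary-injected energy leaves an N-chain on the diffusive time scale, uniformly (no
sub-diffusion, no trapping); a survival statement for ONE covariance, weaker than any N-uniform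
spectral gap (none exists: gap ≤ γ/N). [difficulty: open-problem] (why it might fail: Sub-diffusive
transport or long-lived chaotic breathers near the boundary (strong anharmonicity lam·T ≫ 1, De
Roeck–Huveneers asymptotic localisation) could keep N·S_N(AN²) from vanishing as A → ∞; the exit
identity behind the reading of S is itself unproved (Dynkin for H).) [DeRoeckHuveneers2015,
BeckerMenegaki2022, BonettoLebowitzReyBellet2000, CuneoEckmannHairerReyBellet2018,
LepriLiviPoliti2003]
#5 PositiveTransmission (crux) — NOT AN INSULATOR AT THE DIFFUSIVE SCALE: for all parameters > 0 and
T > 0 there are A₀, c > 0 with N·X_N(A₀·N²) ≥ c for all large N — within a diffusive time a fraction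
≥ c/N of the energy injected at one bath has left through the other (gambler's-ruin lower bound; the
positivity-of-κ content, separated from finiteness). [difficulty: open-problem] (why it might fail:
An Ohmic LOWER bound uniform in N is unproved for any deterministic anharmonic chain; strong
effective anharmonicity suppresses transport super-polynomially (anticontinuum), so c(T) is tiny and
no perturbative handle exists; a hidden insulating mechanism would give E_N = o(1/N).)
[DeRoeckHuveneers2015, BonettoLebowitzReyBellet2000, AokiLukkarinenSpohn2006, LefevereSchenkel2006,
Dhar2008]
#6 ResponseIdentity (crux) — KDN RESPONSE IDENTITY, TRANSMISSION FORM: assuming weak-NESS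
uniqueness, for every steady-state family μ, T > 0 and every N, the BLR difference quotient
totalCurrent(μ_{N,T+δ/2,T−δ/2})/δ → (N−1)·γ·E_N as δ → 0, δ ≠ 0, with E_N = (γ/T²)∫_0^∞Kt_N (N = 0,
1: both sides 0 resp. consistent). Derivation: J̃ = γ(T_L − ⟨p_0²⟩) (energy balance at site 0),
∂_{T_b}⟨p_0²⟩ = (γ/T²)∫_0^∞Cov_T(p_b²(0),p_0²(t))dt (noise-amplitude response, ∂_{T_b}L =
γ∂²_{p_b}), sum rule ∂_{T_L}+∂_{T_R} = d/dT at Gibbs, kernel symmetry Cov(p²_{N−1}(0),p_0²(t)) =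
Cov(p_0²(0),p²_{N−1}(t)) (left–right reflection of the equal-temperature homogeneous chain;
alternatively reversibility up to momentum flip): along (T+δ/2, T−δ/2), dJ̃/dδ = γ(½ −
½∂_{T_L}⟨p_0²⟩ + ½∂_{T_R}⟨p_0²⟩) = γ·∂_{T_R}⟨p_0²⟩ = γ·E_N (checked by hand; N = 1: both sides 0).
[difficulty: L] (why it might fail: Fixed-N linear response at equilibrium is unproved for the
Langevin pinned chain (Hairer–Majda Assumption 5 fails; needs CEHR (2.5)); a sign/normalisation slip
in j_i or in the symmetric driving (T±δ/2) would make the formula, not just its proof, wrong.)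
[KunduDharNarayan2009, ReyBellet2003, HairerMajda2009, BonettoLebowitzReyBellet2000,
CuneoEckmannHairerReyBellet2018, Carmona2007]
#9 KernelIntegrable (support) — the two boundary kernels are integrable on (0,∞) at fixed N
(continuity from the proved Feller property + |K| ≤ 2T² + exponential decay from the proved
ergodicity (2.5) of the equilibrium chain and Gibbs invariance of the constructed kernels); de-junks
X, S, E (Bochner junk 0 otherwise). N = 0: zero kernels. [difficulty: M]
[CuneoEckmannHairerReyBellet2018, BonettoLebowitzReyBellet2000]
#9 SandwichGlue (support) — THE SANDWICH (real analysis; PROVED by the planner: `theorem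
sandwichGlue_holds : SandwichGlue` in GlueCheck.lean, lean check rc 0, axioms
propext/Classical.choice/Quot.sound, ~120 lines via two abstract lemmas kernel_sandwich +
squeeze_abstract — a prover re-files it in Theorems; attached as evidence): BoundaryDEP +
KernelIntegrable give X_N(t) ≤ E_N ≤ X_N(t) + S_N(t) for t > 0 (set-integral monotonicity for a
nonnegative integrable kernel; the upper bound drops the return tail ∫_t^∞K_N ≥ 0); with FH, x_T(A)
≤ liminf N·E_N ≤ limsup N·E_N ≤ x_T(A) + limsup N·S_N(AN²) for every A, so by VS the sequence N·E_N
converges to e = sup_A x_T(A) < ∞, by PT e ≥ c > 0, and (N−1)γE_N = γ·N·E_N − γE_N → γe =: κ_b.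
[difficulty: provable-now] [KunduDharNarayan2009, KipnisLandim1999]
#9 NessUnique (support) — SHARED HYPOTHESIS (signature identical to stmt-AtomisticToContinuum-0741
of FourierGreenKubo; dedup intended): uniqueness of the weak steady state (IsSteadyState class) of
pinnedChain for all N, T_L, T_R > 0; existence is the PROVED pinnedChain_exists_isSteadyState.
[difficulty: L] [CuneoEckmannHairerReyBellet2018, Carmona2007]

TWO-LAYER PLAN. Foreseen glued splits (nothing filed now): BoundaryDEP ⇐ PerturbativeBoundaryDEP
(first order in (lam,β) at every harmonic double zero of 2Cov(p_0,p_y(u))², N ≤ N₀, bounded u: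
finite Wick sums) → LateTimeSign (the slowest even mode of the fixed-N equilibrium generator seen by
p_0² is real with positive weight, or dephasing beats damping) → BoundaryDEP; VanishingSurvival ⇐
ExitIdentity (γ(∫K_N+∫Kt_N) = T², Dynkin for H + proved (2.5)) → DiffusiveSurvivalBound
(Cov_T(p_0²,H_N(AN²)) ≤ s(A)/N, s(A) → 0) → VanishingSurvival; FiniteHorizonTransmission ⇐
FiniteHorizonBound (N·X_N(AN²) ≤ C(A), finite speed + energy-spreading second moment) →
TwoPointScalingLimit (diffusive scaling of the equilibrium boundary-to-boundary energy correlation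
at macroscopic times ≤ A) → FiniteHorizonTransmission; ResponseIdentity ⇐ NoiseAmplitudeResponse
(∂_{T_b}⟨F⟩ = (γ/T²)∫_0^∞Cov(p_b²(0),F(t))dt at equilibrium, fixed N) → BoundaryBookkeeping (energy
balance J̃ = γ(T_L−⟨p_0²⟩), sum rule, kernel symmetry) → ResponseIdentity.

KILL CRITERIA. (a) A certified negative value of K_N(u) or Kt_N(u) whose TAIL integral ∫_u^∞ is also
negative, at any admissible (N, parameters) — e.g. the single pinned quartic oscillator (N = 1, both
baths on site 0) or the dimer — refutes BoundaryDEP: close `refuted:BoundaryDEP` unless the repaired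
tail form (∫_t^∞K_N ≥ 0, ∫_t^∞Kt_N ≥ 0 for all t, which is all the glue uses) survives the witness,
in which case restate (misstated). (b) A proof that N·X_N(AN²) → ∞ for some parameters (residual
ballistic channel) refutes FiniteHorizonTransmission and, with the other items, FouriersLaw itself —
hand the witness to the negative side (open-chain-mazur-bridge). (c) ResponseIdentity's FORMULA
refuted (not mere non-existence of D_N) = bookkeeping error, repair by restate. (d) TransmissionLaw
proved elsewhere by a non-sign method moots the sandwich but not BoundaryDEP; FouriersLaw proved
elsewhere moots the route.

NOT DECOMPOSED YET. The full card conjecture DEP (all pairs x, y; site energies with the FPU-β cross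
term; infinite volume with the Einstein–Helfand reading κ = half the variance growth rate of a
probability kernel) and its comparison/maximum-principle corollaries (0 ≤ ∂_{T_b}⟨p_y²⟩ ≤ 1,
M-matrix for probe networks, transmission ∈ [0,1]) are NOT items: the assembly needs only the two
boundary kernels, and a refutation of an off-boundary or echo-time sign must not break the route;
the engines for BoundaryDEP (second-order Malliavin/tangent-flow curvature split, log-concave
transport of the Gibbs state), the exit identity and kernel symmetry (folded into the docstrings of
VS and ResponseIdentity), T-dependence of e(T), and any identification κ_b = κ_GK are layer-2
matters (D-0019).

CHEAPEST FALSIFIER. EQUILIBRIUM SIMULATION OF THE SHORTEST CHAINS (kit job, this session): BAOAB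
integration of M = 2000 stationary trajectories of the N = 1, 2, 3 chains (ω₂ = T = 1, β = 1; γ ∈
{0.2, 1, 5}, lam ∈ {0.2, 1, 5}; plus FPU-heavy β = 5, lam = 0.2; near-Hamiltonian γ = 0.05 and
overdamped γ = 20; harmonic controls lam = β = 0), estimating K_N(u), Kt_N(u) on u ∈ [0, 60] and the
tail integrals with standard errors across trajectories: ONE robustly negative kernel value (z < −4)
with negative tail kills BoundaryDEP in an afternoon (kit jobs j003677 = quick validation, j003696 =
full grid, submitted 18:50Z/18:55Z this session into a saturated queue — p95 wait ≈ 2 h — so the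
verdict lands as job evidence for the refuter/tenure pass, not in this text; script depjob/main.py
in the planner folder). Second: the first-order sign at the harmonic double zeros for N = 2, 3 by
computer algebra (finite Wick sums), extending the N = 1 hand value +3·lam·T³ > 0.

NUMBERS. K_N(0) = Var(p_0²) = 2T²; Kt_N(0) = 0 for N ≥ 2 (Gibbs momenta independent), Kt_N(u) =
O(u^{2(N−1)})-small at short times; exit identity γ(∫_0^∞K_N + ∫_0^∞Kt_N) = T², i.e. S_N(0) = 1; N =
1: K = Kt, (γ/T²)∫_0^∞K_1 = 1/2. Harmonic anchor (lam = β = 0): K = 2Cov(p_0,p_0(u))², Kt =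
2Cov(p_0,p_{N−1}(u))² ≥ 0, E_N → E_∞ > 0 (RLL flux independent of N; BLR §6.2), so N·X_N(AN²) → ∞:
FH fails exactly there, DEP_b and VS hold. Fourier prediction: E_N ≈ κ/(γN), x_T(A)/e = transmitted
fraction of the Dirichlet heat kernel on [0,1] by time A (→ 1 exponentially), N·S_N(AN²) → s(A) ≍
A^{-1/2} (small A), e^{-π²DA} (large A). Gap of the open chain ≤ γ/N (Becker–Menegaki), harmonic gap
≍ N^{-3}: no rate enters here. Items at open: 10 (1 target, 5 cruxes, 3 support, 1 assembly).

DEFINITION REQUESTS. None: pinnedChain, OscillatorChain.transitionKernel,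
OscillatorChain.gibbsMeasure, OscillatorChain.totalCurrent, OscillatorChain.IsSteadyState,
PhaseSpace, pinnedChain_exists_isSteadyState all exist (lean search --decl; Sketch.lean rc 0).
Wanted later (shared with the network/probe cards, not filed): a multi-thermostat generator to state
DEP for probe sets. Bib: KMP 1982 is cited by DOI (doi:10.1007/bf01011740; not yet in
references.bib).

Novelty: Searches (2026-08-15, on top of the card's two refuter audits which read arXiv:1103.2835 pp.3–4 and
arXiv:0809.0953 pp.3,6 and graded the card new-combination): `lit frontier AtomisticToContinuum
--since 2020` (30 rows; relevant only arXiv:2310.13338 = CanestrariLiveraniOlla2026 and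
arXiv:2604.14056; nothing on correlation signs or limit exchange); `lit search --hybrid "positivity
energy correlation kernel monotone exchange of limits thermodynamic limit long time Green-Kubo heat
conduction chain"` (12 textbook rows, none relevant); `lit search --source crossref` ×6 ("positivity
energy spreading kernel anharmonic chain …" 0 relevant; "survival probability energy transmission
chain oscillators heat baths …" → LefevereSchenkel2006 doi:10.1088/1742-5468/2006/02/l02001,
Carmona2007; "equilibrium energy fluctuations diffusive scaling anharmonic chain …" →
doi:10.1088/1361-6544/ab60da Olla–Xu 2020 (Euler scale, with noise), doi:10.1214/20-ejp488; "Kipnis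
Marchioro Presutti …" → doi:10.1007/bf01011740; "harmonic chain conservative noise …" →
doi:10.1007/s10955-013-0908-4 Basile–Olla 2014, BasileBernardinOlla2009; "Green-Kubo formula open
systems Kundu Dhar Narayan" → doi:10.1088/1742-5468/2009/03/l03001, doi:10.1103/physreve.83.011101);
`lit galaxy search … --star all` ×5 (0 hits each; galaxy substring index returned nothing this hour
— recorded, not retried); openalex budget exhausted (HTTP 429). Route files read: DynamicalGriffiths
(retired rung), EscapeDeficit (retired), FourierGr  [refs: 10.1088/1742-5468/2006/02/l02001, 10.1088/1361-6544/ab60da, 10.1214/20-ejp488, 10.1007/bf01011740, 10.1007/s10955-013-0908-4, 10.1088/1742-5468/2009/03/l03001, 10.1103/physreve.83.011101, 10.1088/1742-5468/2009/03/l03001:, 10.1007/bf01011740:, 1103.2835, 0809.0953, 2310.13338, 2604.14056, doi:10.1088/1742-5468/2006/02/l02001, doi:10.1088/1361-6544/ab60da, doi:10.1214/20-ejp488, doi:10.1007/bf01011]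

Barriers (technique_class: correlation-sign positive-kernel limit-exchange): - technique_class: correlation-sign positive-kernel limit-exchange
- Literature.Barriers.AtomisticToContinuum.HarmonicChainBallisticFlux: embraced — BoundaryDEP and
VanishingSurvival HOLD for the refuted harmonic member (Isserlis; ballistic exit), so they cannot
imply the conjunct alone; the ballistic member is excluded exactly by FiniteHorizonTransmission
(N·X_N(AN²) → ∞ there), which is where the route's finiteness content sits; the sign is a lever,
never a transport estimate.
- Literature.Barriers.AtomisticToContinuum.BeckerMenegaki2022_gapClosing: evaded by design — no
N-uniform relaxation rate, gap or mixing time is used anywhere: the t → ∞ tails ∫_{AN²}^∞ are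
controlled by SIGN (they can only add transmission / are bounded by the surviving fraction), not by
decay; fixed-N ergodicity (proved (2.5)) enters only KernelIntegrable, with N-dependent constants
that never reach the assembly.
- Literature.Barriers.AtomisticToContinuum.HasBoundedResponse: addressed, not assumed — limsup N·E_N
≤ x_T(A) + limsup N·S_N(AN²) < ∞ is DERIVED from BoundaryDEP + FH + VS; the fixed-N tools
(ResponseIdentity, KernelIntegrable) are used only at fixed N, as the barrier allows; the
N-dependence is carried by the finite-horizon cruxes, which are not fixed-N statements.
- Literature.Barriers.AtomisticToContinuum.MacroErgodicityBarrier: it does not evade it for FH's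
limit-existence clause; the bet is that a TWO-POINT equilibrium fluctuation statement for one
boundary observable at finite macrosc

History (route lifecycle, newest last):
- 2026-08-22T03:24:29Z · DORMANT — reconciler: no traction for 5 d (last activity item-evidence-added at 2026-08-17T02:12:43Z); parked, not closed — `ledger route dormant route-AtomisticToContinu (operator:999:132048)

sub-problem: FouriersLaw · status: dormant · opened planner-plancard-AtomisticToContinuum-Fourier-745a3ff0-g2-0 2026-08-15T19:00:37Z · rev 6 · ledger route-AtomisticToContinuum-GriffithsLimitExchange
GENERATED by the gate from the ledger (D-0016/17). Provers cite these decls: `theorem foo : Summit.AtomisticToContinuum.FouriersLaw.Theses.GriffithsLimitExchange.<Decl> := …` in Summits/AtomisticToContinuum/FouriersLaw/Theorems/<Name>.lean.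
-/

namespace Summit.AtomisticToContinuum.FouriersLaw.Theses.GriffithsLimitExchange

open scoped BigOperators Topology Manifold Classical MeasureTheory ProbabilityTheory Matrix InnerProductSpace ComplexConjugate ContinuousMap
open Filter Set Function TopologicalSpace MeasureTheory

attribute [summit_statement] _root_.FouriersLaw

/-- item stmt-AtomisticToContinuum-13197 · target · rank 0 · open · by planner
why it might fail: Inherits FH (a residual ballistic channel makes N·E_N → ∞, as for lam = β = 0), PT (localisation-like suppression E_N = o(1/N)) and VS; and it presumes D_N ∝ E_N (ResponseIdentity).
sources: KunduDharNarayan2009, BonettoLebowitzReyBellet2000, RiederLebowitzLieb1967, Dhar2008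
[target] TRANSMISSION LAW (= X_b of the retired EscapeDeficit in transmission form): for all
parameters > 0 and T > 0 there is κ_b > 0 with (N−1)·γ·E_N → κ_b, E_N = (γ/T²)∫_0^∞ Kt_N(u)du the
end-to-end kinetic-energy transmission of the equilibrium N-chain (N = 0: kernels are 0 by
convention). Conclusion of SandwichGlue; with ResponseIdentity it is clause (ii) of FouriersLawFor
with κ = κ_b. -/
@[route_item "route-AtomisticToContinuum-GriffithsLimitExchange"]
def TransmissionLaw : Prop :=
  ∀ ω₂ lam β γ : ℝ, 0 < ω₂ → 0 < lam → 0 < β → 0 < γ → ∀ T : ℝ, 0 < T → (let P := Literature.MathematicalPhysics.KineticTheory.HeatConduction.pinnedChain ω₂ lam β γ; let Kt : ℕ → ℝ → ℝ := fun N u => if h : 0 < N then ∫ z, ((z.2 ⟨0, h⟩) ^ 2 - T) * (∫ y, ((y.2 ⟨N - 1, by omega⟩) ^ 2 - T) ∂(P.transitionKernel N T T u.toNNReal z)) ∂(P.gibbsMeasure N T) else 0; let E : ℕ → ℝ := fun N => γ / T ^ 2 * ∫ u in Set.Ioi (0 : ℝ), Kt N u; ∃ κb : ℝ, 0 < κb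 ∧ Filter.Tendsto (fun N : ℕ => ((N : ℝ) - 1) * γ * E N) Filter.atTop (nhds κb))

/-- item stmt-AtomisticToContinuum-13198 · crux · rank 2 · open · by planner
why it might fail: At the harmonic double zeros (quarter periods, echo/arrival times) the O(lam,β) flow correction decides the sign (+3lamT³ by hand only for N=1, γ→0); at fixed small N a complex slowest even mode would make K oscillate around 0 at late u; strong damping γ ≫ ω₂ untested.
sources: doi:10.1063/1.1664600, doi:10.1007/s002200050102, doi:10.1007/bf01011740, RiederLebowitzLieb1967, AokiLukkarinenSpohn2006, Zhao2006
[crux] DYNAMICAL GRIFFITHS INEQUALITY AT THE THERMOSTATTED SITES (card conjecture DEP_kin restricted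
to the pairs (0,0) and (0,N−1)): for all ω₂, lam, β, γ > 0, T > 0, every N ≥ 1 and u ≥ 0, K_N(u) =
Cov_T(p_0²(0), p_0²(u)) ≥ 0 and Kt_N(u) = Cov_T(p_0²(0), p²_{N−1}(u)) ≥ 0 (constructed kernels,
Gibbs state, both baths at T): kinetic energy injected at a bath site is, on average, never missing
at either bath site later. Exact at lam = β = 0 (Isserlis: 2Cov(p_0,p_y(u))² ≥ 0, with double
zeros), in KMP/noisy duals, and at leading kinetic order. Only the TAIL form ∫_t^∞ ≥ 0 is used by
the glue. [difficulty: open-problem] -/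
@[route_item "route-AtomisticToContinuum-GriffithsLimitExchange", crux]
def BoundaryDEP : Prop :=
  ∀ ω₂ lam β γ : ℝ, 0 < ω₂ → 0 < lam → 0 < β → 0 < γ → ∀ T : ℝ, 0 < T → (let P := Literature.MathematicalPhysics.KineticTheory.HeatConduction.pinnedChain ω₂ lam β γ; let K : ℕ → ℝ → ℝ := fun N u => if h : 0 < N then ∫ z, ((z.2 ⟨0, h⟩) ^ 2 - T) * (∫ y, ((y.2 ⟨0, h⟩) ^ 2 - T) ∂(P.transitionKernel N T T u.toNNReal z)) ∂(P.gibbsMeasure N T) else 0; let Kt : ℕ → ℝ → ℝ := fun N u => if h : 0 < N then ∫ z, ((z.2 ⟨0, h⟩) ^ 2 - T) * (∫ y, ((y.2 ⟨N - 1, by omega⟩) ^ 2 - T) ∂(P.transitionKernel N T T u.toNNReal z)) ∂(P.gibbsMeasure N T) else 0; ∀ (N : ℕ) (u : ℝ), 0 ≤ u → 0 ≤ K N u ∧ 0 ≤ Kt N u)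

/-- item stmt-AtomisticToContinuum-13199 · crux · rank 3 · open · by planner
why it might fail: A residual ballistic/superdiffusive channel at some (lam,β,T) gives N·X_N(AN²) → ∞; even if O(1), the N→∞ limit may fail to exist without a hydrodynamic limit for the deterministic bulk (macro-ergodicity unproved); O(1) Kapitza layers must converge too.
sources: BonettoLebowitzReyBellet2000, Spohn2014, MendlSpohn2015, Bernardin2014, KipnisLandim1999, LepriLiviPoliti2003
[crux] FINITE-HORIZON TRANSMISSION HAS A SCALING LIMIT: for all parameters > 0, T > 0 and every
macroscopic horizon A > 0, N·X_N(A·N²) = N·(γ/T²)∫_0^{AN²} Kt_N(u)du converges to a real number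
x_T(A) as N → ∞ — the energy that has crossed the chain by the diffusive time AN² is (x_T(A) +
o(1))/N. Finiteness is the no-ballistic-channel content (false for the harmonic chain, where X_N →
E_∞ > 0); existence of the limit is a two-point equilibrium-fluctuation (linearised hydrodynamic)
statement at FINITE macroscopic time, expected x_T(A) = e(T)·F(A) with F the transmitted fraction of
the heat kernel on [0,1] with absorbing ends. [difficulty: open-problem] -/
@[route_item "route-AtomisticToContinuum-GriffithsLimitExchange", crux]
def FiniteHorizonTransmission : Prop :=
  ∀ ω₂ lam β γ : ℝ, 0 < ω₂ → 0 < lam → 0 < β → 0 < γ → ∀ T : ℝ, 0 < T → (let P := Literature.MathematicalPhysics.KineticTheory.HeatConduction.pinnedChain ω₂ lam β γ; let Kt : ℕ → ℝ → ℝ := fun N u => if h : 0 < N then ∫ z, ((z.2 ⟨0, h⟩) ^ 2 - T) * (∫ y, ((y.2 ⟨N - 1, by omega⟩) ^ 2 - T) ∂(P.transitionKernel N T T u.toNNReal z)) ∂(P.gibbsMeasure N T) else 0; let X : ℕ → ℝ → ℝ := fun N t => γ / T ^ 2 * ∫ u in Set.Ioc (0 : ℝ) t, Kt N u; ∀ A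 : ℝ, 0 < A → ∃ x : ℝ, Filter.Tendsto (fun N : ℕ => (N : ℝ) * X N (A * (N : ℝ) ^ 2)) Filter.atTop (nhds x))

/-- item stmt-AtomisticToContinuum-13200 · crux · rank 4 · open · by planner
why it might fail: Sub-diffusive transport or long-lived chaotic breathers near the boundary (strong anharmonicity lam·T ≫ 1, De Roeck–Huveneers asymptotic localisation) could keep N·S_N(AN²) from vanishing as A → ∞; the exit identity behind the reading of S is itself unproved (Dynkin for H).
sources: DeRoeckHuveneers2015, BeckerMenegaki2022, BonettoLebowitzReyBellet2000, CuneoEckmannHairerReyBellet2018, LepriLiviPoliti2003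
[crux] VANISHING DIFFUSIVE SURVIVAL: for all parameters > 0 and T > 0: for every ε > 0 there is a
horizon A with N·S_N(A·N²) ≤ ε for all large N, where S_N(t) = (γ/T²)∫_t^∞ (K_N + Kt_N) — by the
exit identity γ(∫_0^∞K_N + ∫_0^∞Kt_N) = T² and energy balance, S_N(t) = Cov_T(p_0²(0), H_N(t))/T² is
the fraction of the injected boundary energy still inside the chain at time t. Says:
boundary-injected energy leaves an N-chain on the diffusive time scale, uniformly (no sub-diffusion,
no trapping); a survival statement for ONE covariance, weaker than any N-uniform spectral gap (none
exists: gap ≤ γ/N). [difficulty: open-problem] -/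
@[route_item "route-AtomisticToContinuum-GriffithsLimitExchange", crux]
def VanishingSurvival : Prop :=
  ∀ ω₂ lam β γ : ℝ, 0 < ω₂ → 0 < lam → 0 < β → 0 < γ → ∀ T : ℝ, 0 < T → (let P := Literature.MathematicalPhysics.KineticTheory.HeatConduction.pinnedChain ω₂ lam β γ; let K : ℕ → ℝ → ℝ := fun N u => if h : 0 < N then ∫ z, ((z.2 ⟨0, h⟩) ^ 2 - T) * (∫ y, ((y.2 ⟨0, h⟩) ^ 2 - T) ∂(P.transitionKernel N T T u.toNNReal z)) ∂(P.gibbsMeasure N T) else 0; let Kt : ℕ → ℝ → ℝ := fun N u => if h : 0 < N then ∫ z, ((z.2 ⟨0, h⟩) ^ 2 - T) * (∫ y, ((y.2 ⟨N - 1, by omega⟩) ^ 2 - T) ∂(P.transitionKernel N T T u.toNNReal z)) ∂(P.gibbsMeasure N T) else 0; let S : ℕ → ℝ → ℝ := fun N t => γ / T ^ 2 * ∫ u in Set.Ioi t, (K N u + Kt N u); ∀ ε : ℝ, 0 < ε → ∃ A : ℝ, 0 < A ∧ ∀ᶠ N : ℕ in Filter.atTop, (N : ℝ) * S N (A * (N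 : ℝ) ^ 2) ≤ ε)

/-- item stmt-AtomisticToContinuum-13201 · crux · rank 5 · open · by planner
why it might fail: An Ohmic LOWER bound uniform in N is unproved for any deterministic anharmonic chain; strong effective anharmonicity suppresses transport super-polynomially (anticontinuum), so c(T) is tiny and no perturbative handle exists; a hidden insulating mechanism would give E_N = o(1/N).
sources: DeRoeckHuveneers2015, BonettoLebowitzReyBellet2000, AokiLukkarinenSpohn2006, LefevereSchenkel2006, Dhar2008
[crux] NOT AN INSULATOR AT THE DIFFUSIVE SCALE: for all parameters > 0 and T > 0 there are A₀, c > 0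
with N·X_N(A₀·N²) ≥ c for all large N — within a diffusive time a fraction ≥ c/N of the energy
injected at one bath has left through the other (gambler's-ruin lower bound; the positivity-of-κ
content, separated from finiteness). [difficulty: open-problem] -/
@[route_item "route-AtomisticToContinuum-GriffithsLimitExchange", crux]
def PositiveTransmission : Prop :=
  ∀ ω₂ lam β γ : ℝ, 0 < ω₂ → 0 < lam → 0 < β → 0 < γ → ∀ T : ℝ, 0 < T → (let P := Literature.MathematicalPhysics.KineticTheory.HeatConduction.pinnedChain ω₂ lam β γ; let Kt : ℕ → ℝ → ℝ := fun N u => if h : 0 < N then ∫ z, ((z.2 ⟨0, h⟩) ^ 2 - T) * (∫ y, ((y.2 ⟨N - 1, by omega⟩) ^ 2 - T) ∂(P.transitionKernel N T T u.toNNReal z)) ∂(P.gibbsMeasure N T) else 0; let X : ℕ → ℝ → ℝ := fun N t => γ / T ^ 2 * ∫ u in Set.Ioc (0 : ℝ) t, Kt N u; ∃ A c : ℝ, 0 < A ∧ 0 < c ∧ ∀ᶠ N : ℕ in Filter.atTop, c ≤ (N : ℝ) * X N (A * (N : ℝ) ^ 2))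

/-- item stmt-AtomisticToContinuum-13202 · crux · rank 6 · open · by planner
why it might fail: Fixed-N linear response at equilibrium is unproved for the Langevin pinned chain (Hairer–Majda Assumption 5 fails; needs CEHR (2.5)); a sign/normalisation slip in j_i or in the symmetric driving (T±δ/2) would make the formula, not just its proof, wrong.
sources: KunduDharNarayan2009, ReyBellet2003, HairerMajda2009, BonettoLebowitzReyBellet2000, CuneoEckmannHairerReyBellet2018, Carmona2007
[crux] KDN RESPONSE IDENTITY, TRANSMISSION FORM: assuming weak-NESS uniqueness, for every
steady-state family μ, T > 0 and every N, the BLR difference quotient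
totalCurrent(μ_{N,T+δ/2,T−δ/2})/δ → (N−1)·γ·E_N as δ → 0, δ ≠ 0, with E_N = (γ/T²)∫_0^∞Kt_N (N = 0,
1: both sides 0 resp. consistent). Derivation: J̃ = γ(T_L − ⟨p_0²⟩) (energy balance at site 0),
∂_{T_b}⟨p_0²⟩ = (γ/T²)∫_0^∞Cov_T(p_b²(0),p_0²(t))dt (noise-amplitude response, ∂_{T_b}L =
γ∂²_{p_b}), sum rule ∂_{T_L}+∂_{T_R} = d/dT at Gibbs, kernel symmetry Cov(p²_{N−1}(0),p_0²(t)) =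
Cov(p_0²(0),p²_{N−1}(t)) (left–right reflection of the equal-temperature homogeneous chain;
alternatively reversibility up to momentum flip): along (T+δ/2, T−δ/2), dJ̃/dδ = γ(½ −
½∂_{T_L}⟨p_0²⟩ + ½∂_{T_R}⟨p_0²⟩) = γ·∂_{T_R}⟨p_0²⟩ = γ·E_N (checked by hand; N = 1: both sides 0).
[difficulty: L] -/
@[route_item "route-AtomisticToContinuum-GriffithsLimitExchange", crux]
def ResponseIdentity : Prop :=
  ∀ ω₂ lam β γ : ℝ, 0 < ω₂ → 0 < lam → 0 < β → 0 < γ → (∀ (N : ℕ) (T_L T_R : ℝ), 0 < T_L → 0 < T_R → ∀ μ ν : MeasureTheory.Measure (Literature.MathematicalPhysics.KineticTheory.HeatConduction.PhaseSpace N), (Literature.MathematicalPhysics.KineticTheory.HeatConduction.pinnedChain ω₂ lam β γ).IsSteadyState N T_L T_R μ → (Literature.MathematicalPhysics.KineticTheory.HeatConduction.pinnedChain ω₂ lam β γ).IsSteadyState N T_L T_R ν → μ = ν) → ∀ μ : (N : ℕ) → ℝ → ℝ → MeasureTheory.Measure (Literature.MathematicalPhysics.KineticTheory.HeatConduction.PhaseSpace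 N), (∀ (N : ℕ) (T_L T_R : ℝ), 0 < T_L → 0 < T_R → (Literature.MathematicalPhysics.KineticTheory.HeatConduction.pinnedChain ω₂ lam β γ).IsSteadyState N T_L T_R (μ N T_L T_R)) → ∀ T : ℝ, 0 < T → (let P := Literature.MathematicalPhysics.KineticTheory.HeatConduction.pinnedChain ω₂ lam β γ; let Kt : ℕ → ℝ → ℝ := fun N u => if h : 0 < N then ∫ z, ((z.2 ⟨0, h⟩) ^ 2 - T) * (∫ y, ((y.2 ⟨N - 1, by omega⟩) ^ 2 - T) ∂(P.transitionKernel N T T u.toNNReal z)) ∂(P.gibbsMeasure N T) else 0; let E : ℕ → ℝ := fun N => γ / T ^ 2 * ∫ u in Set.Ioi (0 : ℝ), Kt N u; ∀ N : ℕ, Filter.Tendsto (fun δ : ℝ => P.totalCurrent (μ N (T + δ / 2) (T - δ / 2)) / δ) (nhdsWithin 0 {(0 : ℝ)}ᶜ) (nhds (((N : ℝ) - 1) * γ * E N)))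

/-- item stmt-AtomisticToContinuum-0741 · support · rank 9 · closed · proved by Summit.AtomisticToContinuum.FouriersLaw.Theorems.nessUnique_proof (prover) · by planner
[crux] UNIQUENESS OF THE WEAK STEADY STATE (the half of stmt-0706 not covered by the landed fact
Literature.MathematicalPhysics.KineticTheory.HeatConduction.CuneoEckmannHairerReyBellet2018_pinnedChain,
p3544): for pinnedChain ω₂ lam β γ (all > 0), every N and T_L, T_R > 0, any two measures in the weak
Fokker–Planck class IsSteadyState (probability, ∫ L f dμ = 0 for f ∈ C_c^∞, bond currents
integrable) coincide. Print: uniqueness of the INVARIANT MEASURE of the Langevin semigroup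
(CuneoEckmannHairerReyBellet2018 Thm 2.13(1): C1, C2, CA; Carmona2007 Thm 1.1(iii)); the item
additionally needs 'weak stationary probability solution of L*μ = 0 ⇒ P_t-invariant' for this
hypoelliptic L with cubic drift (Echeverría 1982 well-posed martingale problem on C_c^∞ +
non-explosion via e^{θH}; Bogachev–Krylov–Röckner–Shaposhnikov 2015 Ch. 5 is non-degenerate only) —
the FP-identification lemma is the formal crux. N = 0: PhaseSpace 0 is a point (unique probability
measure); N = 1: both baths on site 0, OU at temperature (T_L+T_R)/2. This is exactly the hypothesis
of FiniteResponse and ThermodynamicLimit and, with the fact, gives clause (i) of FouriersLawFor. -/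
@[route_item "route-AtomisticToContinuum-GriffithsLimitExchange", crux]
def NessUnique : Prop :=
  ∀ ω₂ lam β γ : ℝ, 0 < ω₂ → 0 < lam → 0 < β → 0 < γ → ∀ (N : ℕ) (T_L T_R : ℝ), 0 < T_L → 0 < T_R → ∀ μ ν : MeasureTheory.Measure (Literature.MathematicalPhysics.KineticTheory.HeatConduction.PhaseSpace N), (Literature.MathematicalPhysics.KineticTheory.HeatConduction.pinnedChain ω₂ lam β γ).IsSteadyState N T_L T_R μ → (Literature.MathematicalPhysics.KineticTheory.HeatConduction.pinnedChain ω₂ lam β γ).IsSteadyState N T_L T_R ν → μ = ν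

/-- `NessUnique` holds: proved by `Summit.AtomisticToContinuum.FouriersLaw.Theorems.nessUnique_proof`. -/
theorem NessUnique_holds : NessUnique := _root_.Summit.AtomisticToContinuum.FouriersLaw.Theorems.nessUnique_proof

/-- item stmt-AtomisticToContinuum-13203 · support · rank 9 · closed · proved by Summit.AtomisticToContinuum.FouriersLaw.Theorems.GriffithsLimitExchange.kernelIntegrable_proof (prover) · by planner
sources: CuneoEckmannHairerReyBellet2018, BonettoLebowitzReyBellet2000
[support] the two boundary kernels are integrable on (0,∞) at fixed N (continuity from the proved
Feller property + |K| ≤ 2T² + exponential decay from the proved ergodicity (2.5) of the equilibrium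
chain and Gibbs invariance of the constructed kernels); de-junks X, S, E (Bochner junk 0 otherwise).
N = 0: zero kernels. [difficulty: M] -/
@[route_item "route-AtomisticToContinuum-GriffithsLimitExchange", crux]
def KernelIntegrable : Prop :=
  ∀ ω₂ lam β γ : ℝ, 0 < ω₂ → 0 < lam → 0 < β → 0 < γ → ∀ T : ℝ, 0 < T → (let P := Literature.MathematicalPhysics.KineticTheory.HeatConduction.pinnedChain ω₂ lam β γ; let K : ℕ → ℝ → ℝ := fun N u => if h : 0 < N then ∫ z, ((z.2 ⟨0, h⟩) ^ 2 - T) * (∫ y, ((y.2 ⟨0, h⟩) ^ 2 - T) ∂(P.transitionKernel N T T u.toNNReal z)) ∂(P.gibbsMeasure N T) else 0; let Kt : ℕ → ℝ → ℝ := fun N u => if h : 0 < N then ∫ z, ((z.2 ⟨0, h⟩) ^ 2 - T) * (∫ y, ((y.2 ⟨N - 1, by omega⟩) ^ 2 - T) ∂(P.transitionKernel N T T u.toNNReal z)) ∂(P.gibbsMeasure N T) else 0; ∀ N : ℕ, MeasureTheory.IntegrableOn (K N) (Set.Ioi 0) ∧ MeasureTheory.IntegrableOn (Kt N) (Set.Ioi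 0))

/-- item stmt-AtomisticToContinuum-13204 · support · rank 9 · closed · proved by Summit.AtomisticToContinuum.FouriersLaw.Theorems.sandwichGlue_proof @ 86440a1afaa2 (prover) · by planner
sources: KunduDharNarayan2009, KipnisLandim1999
[support] THE SANDWICH (real analysis; PROVED by the planner: `theorem sandwichGlue_holds :
SandwichGlue` in GlueCheck.lean, lean check rc 0, axioms propext/Classical.choice/Quot.sound, ~120
lines via two abstract lemmas kernel_sandwich + squeeze_abstract — a prover re-files it in Theorems;
attached as evidence): BoundaryDEP + KernelIntegrable give X_N(t) ≤ E_N ≤ X_N(t) + S_N(t) for t > 0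
(set-integral monotonicity for a nonnegative integrable kernel; the upper bound drops the return
tail ∫_t^∞K_N ≥ 0); with FH, x_T(A) ≤ liminf N·E_N ≤ limsup N·E_N ≤ x_T(A) + limsup N·S_N(AN²) for
every A, so by VS the sequence N·E_N converges to e = sup_A x_T(A) < ∞, by PT e ≥ c > 0, and
(N−1)γE_N = γ·N·E_N − γE_N → γe =: κ_b. [difficulty: provable-now] -/
@[route_item "route-AtomisticToContinuum-GriffithsLimitExchange", crux]
def SandwichGlue : Prop :=
  BoundaryDEP → KernelIntegrable → FiniteHorizonTransmission → PositiveTransmission → VanishingSurvival → TransmissionLaw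

/-- item stmt-AtomisticToContinuum-13205 · assembly · rank 1 · closed · proved by Summit.AtomisticToContinuum.FouriersLaw.Theorems.griffithsLimitExchange_assembly_proof @ 6465552124c4 (prover) · by planner
sources: KunduDharNarayan2009, BonettoLebowitzReyBellet2000
[assembly] BoundaryDEP → KernelIntegrable → FiniteHorizonTransmission → PositiveTransmission →
VanishingSurvival → SandwichGlue → ResponseIdentity → NessUnique → FouriersLaw (the deciding
theorem's type; `assembly_holds : Assembly := closes` in Sketch.lean). -/
@[route_item "route-AtomisticToContinuum-GriffithsLimitExchange"]
def Assembly : Prop :=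
  BoundaryDEP → KernelIntegrable → FiniteHorizonTransmission → PositiveTransmission → VanishingSurvival → SandwichGlue → ResponseIdentity → NessUnique → _root_.FouriersLaw

/-! D-0027 §2.1 — DECIDING THEOREM (planner-authored via `route open/edit --closes-file`; by planner-rrepair-AtomisticToContinuum-Griffiths-7ba314ab-0 2026-08-15T20:17:59Z):
its hypotheses are this route's items and its conclusion the sub-problem Statement (glue_lint), and it elaborates with this file. -/

@[closes "route-AtomisticToContinuum-GriffithsLimitExchange"] theorem closes (hDEP : BoundaryDEP) (hKI : KernelIntegrable) (hFH : FiniteHorizonTransmission)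
    (hPT : PositiveTransmission) (hVS : VanishingSurvival) (hSG : SandwichGlue)
    (hRI : ResponseIdentity) (hNU : NessUnique) : _root_.FouriersLaw := by
  -- FouriersLaw = ∀ parameters > 0, FouriersLawFor (pinnedChain …) = clause (i) ∧ clause (ii).
  -- (rev 6, route-repair 2026-08-15: NessUnique = shared item stmt-AtomisticToContinuum-0741, re-attached; proof unchanged.)
  intro ω₂ lam β γ hω hl hβ hγ
  have huniq := hNU ω₂ lam β γ hω hl hβ hγ
  refine ⟨?_, ?_⟩
  · -- clause (i): existence from the LANDED theorem `pinnedChain_exists_isSteadyState` (all N) + item NessUnique.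
    intro N T_L T_R hL hR
    obtain ⟨μ, hμ⟩ :=
      Literature.MathematicalPhysics.KineticTheory.HeatConduction.pinnedChain_exists_isSteadyState
        hω hl hβ hγ N hL hR
    exact ⟨μ, hμ, fun ν hν => huniq N T_L T_R hL hR ν μ hν hμ⟩
  · -- clause (ii): the sandwich glue turns the sign crux + the three finite-horizon cruxes into the
    -- transmission law (N-1)·γ·E_N → κ_b(T) > 0; κ T := that κ_b for T > 0 (else 1); for a steady-state
    -- family the response identity gives the difference-quotient limits D_N = (N-1)·γ·E_N.
    have hTL : TransmissionLaw := hSG hDEP hKI hFH hPT hVS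
    classical
    refine ⟨fun T => if hT : 0 < T then Classical.choose (hTL ω₂ lam β γ hω hl hβ hγ T hT) else 1,
      ?_, ?_⟩
    · intro T hT
      simp only [dif_pos hT]
      exact (Classical.choose_spec (hTL ω₂ lam β γ hω hl hβ hγ T hT)).1
    · intro μ hμ T hT
      have hD := hRI ω₂ lam β γ hω hl hβ hγ huniq μ hμ T hT
      refine ⟨_, hD, ?_⟩
      simp only [dif_pos hT]
      exact (Classical.choose_spec (hTL ω₂ lam β γ hω hl hβ hγ T hT)).2

end Summit.AtomisticToContinuum.FouriersLaw.Theses.GriffithsLimitExchange
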